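import Mathlib
import HarnessLib
import Summits.AtomisticToContinuum.Crystallization.Theorems.PricedLinkCensusSoftFourRingsFacetCap

/-!
# Facet caps of the twelve link directions are small — `Cap` variant (local covering hypothesis)

Route `PricedLinkCensus`, item `SoftFourRings` (stmt-AtomisticToContinuum-14234).  This is the
root of the `Cap` variant of the soft-four-rings chain (seat c3): the tree's
`PricedLinkCensusSoftFourRingsFacetCap` derives the facet-cap bound `‖c‖ < 2/(2 − 0.957²)`
(empty circumscribed caps have angular radius `< 57.18°`) from the GLOBAL named fact
`musinTarasov2012_tammes_thirteen` (Tammes' problem for thirteen points, unproved in the tree).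
All that the chain ever uses of it is the LOCAL covering property of the twelve directions `X`
themselves,

  `hT : ∀ p, ‖p‖ = 1 → ∃ x ∈ X, dist p x < 0.957`

(every direction is within chordal distance `0.957`, i.e. `57.17°`, of a point of `X`), which is
proved for the actual link directions separately (from their bond structure).  Here the two root
lemmas are re-proved from this hypothesis, with the SAME names and argument lists (in the
namespace `…Theorems.Cap`), so that the rest of the chain transfers verbatim; the separation and
cardinality arguments are kept (unused) for positional compatibility.
-/

namespace Summit.AtomisticToContinuum.Crystallization.Theorems.Cap

open Real RealInnerProductSpace Literature.Geometry.DiscreteGeometry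

/-- **Supporting functionals of a `0.957`-covering set of directions are short**: if every unit
vector is within chordal distance `0.957` of `X` and `⟪c, y⟫ ≤ 1` for all `y ∈ X`, then
`‖c‖ < 2/(2 − 0.957²)`; for a facet or edge normal `c` (`1/‖c‖ = cos R`, `R` the angular radius of
its empty circumscribed cap) this is `R < 57.18°`.  (Same name and argument list as the tree's
Tammes-conditional lemma; `_hcard`, `_hsep` are not used.) [folklore] -/
theorem norm_lt_of_forall_inner_le_one {X : Finset (EuclideanSpace ℝ (Fin 3))}
    (hT : ∀ p : EuclideanSpace ℝ (Fin 3), ‖p‖ = 1 → ∃ x ∈ X, dist p x < 0.957)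
    (hX1 : ∀ y ∈ X, ‖y‖ = 1) (_hcard : 12 ≤ X.card)
    (_hsep : ∀ u ∈ X, ∀ v ∈ X, u ≠ v → (0.957 : ℝ) ≤ dist u v) {c : EuclideanSpace ℝ (Fin 3)}
    (hc : ∀ y ∈ X, ⟪c, y⟫ ≤ 1) : ‖c‖ < 2 / (2 - 0.957 ^ 2) := by
  by_contra hge
  push Not at hge
  have hK : (1 : ℝ) < 2 / (2 - 0.957 ^ 2) := by norm_num
  have hcn : 0 < ‖c‖ := by linarith
  set p : EuclideanSpace ℝ (Fin 3) := ‖c‖⁻¹ • c with hp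
  have hp1 : ‖p‖ = 1 := by
    rw [hp, norm_smul, norm_inv, norm_norm, inv_mul_cancel₀ hcn.ne']
  have hpy : ∀ y ∈ X, ⟪p, y⟫ ≤ ‖c‖⁻¹ := by
    intro y hy
    rw [hp, real_inner_smul_left]
    calc ‖c‖⁻¹ * ⟪c, y⟫ ≤ ‖c‖⁻¹ * 1 :=
          mul_le_mul_of_nonneg_left (hc y hy) (inv_nonneg.2 hcn.le)
      _ = ‖c‖⁻¹ := mul_one _
  have hinv : ‖c‖⁻¹ ≤ (2 - 0.957 ^ 2) / 2 := by
    rw [inv_le_comm₀ hcn (by norm_num), inv_div]; exact hge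
  obtain ⟨y, hy, hdy⟩ := hT p hp1
  have hd : dist p y ^ 2 = 2 - 2 * ⟪p, y⟫ := by
    rw [dist_eq_norm, ← real_inner_self_eq_norm_sq, inner_sub_left, inner_sub_right,
      inner_sub_right, real_inner_self_eq_norm_sq, real_inner_self_eq_norm_sq, hp1, hX1 y hy,
      real_inner_comm p y]
    ring
  have h2 : dist p y ^ 2 < (0.957 : ℝ) ^ 2 := pow_lt_pow_left₀ hdy dist_nonneg two_ne_zero
  rw [hd] at h2
  linarith [hpy y hy]

/-- **Hull edges and facet diagonals of a `0.957`-covering set of directions are shorter than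
`114.4°`**: two tight points `y ≠ y'` of a supporting functional `c` of `X` (`⟪c, ·⟫ ≤ 1` on `X`,
`= 1` at `y, y'`) have `⟪y, y'⟫ > 2·((2 − 0.957²)/2)² − 1 ≈ −0.4123`. [folklore] -/
theorem inner_gt_of_tight_of_twelve_le_card {X : Finset (EuclideanSpace ℝ (Fin 3))}
    (hT : ∀ p : EuclideanSpace ℝ (Fin 3), ‖p‖ = 1 → ∃ x ∈ X, dist p x < 0.957)
    (hX1 : ∀ y ∈ X, ‖y‖ = 1) (hcard : 12 ≤ X.card)
    (hsep : ∀ u ∈ X, ∀ v ∈ X, u ≠ v → (0.957 : ℝ) ≤ dist u v) {c : EuclideanSpace ℝ (Fin 3)}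
    (hc : ∀ y ∈ X, ⟪c, y⟫ ≤ 1) {y y' : EuclideanSpace ℝ (Fin 3)} (hy : y ∈ X) (hy' : y' ∈ X)
    (hcy : ⟪c, y⟫ = 1) (hcy' : ⟪c, y'⟫ = 1) :
    2 * ((2 - 0.957 ^ 2) / 2) ^ 2 - 1 < ⟪y, y'⟫ := by
  have hlt := norm_lt_of_forall_inner_le_one hT hX1 hcard hsep hc
  have hc0 : c ≠ 0 := by
    rintro rfl
    rw [inner_zero_left] at hcy
    exact zero_ne_one hcy
  have hcn : 0 < ‖c‖ := norm_pos_iff.2 hc0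
  have hge := inner_ge_of_tight (hX1 y hy) (hX1 y' hy') hc0 hcy hcy'
  have hK0 : (0 : ℝ) < 2 / (2 - 0.957 ^ 2) := by norm_num
  have hsq : ‖c‖ ^ 2 < (2 / (2 - 0.957 ^ 2)) ^ 2 := by
    exact pow_lt_pow_left₀ hlt hcn.le two_ne_zero
  have h2 : 2 / (2 / (2 - 0.957 ^ 2)) ^ 2 < 2 / ‖c‖ ^ 2 :=
    div_lt_div_of_pos_left (by norm_num) (by positivity) hsq
  have h3 : (2 : ℝ) / (2 / (2 - 0.957 ^ 2)) ^ 2 = 2 * ((2 - 0.957 ^ 2) / 2) ^ 2 := by norm_num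
  linarith

end Summit.AtomisticToContinuum.Crystallization.Theorems.Cap
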